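import Summits.NavierStokesRegularity.NavierStokesRegularity.Theorems.QuantisedSymmetryPolyhedralTruncationBridge
import Summits.NavierStokesRegularity.NavierStokesRegularity.Theorems.QuantisedSymmetryPolyhedralDssProfileExistsDominatesBlowupProfile
import Summits.NavierStokesRegularity.NavierStokesRegularity.Theorems.QuantisedSymmetryPolyhedralDssProfileExistsOfCell
import Literature.Analysis.Calculus.QuadraticMapKantorovich
import Literature.Analysis.Calculus.RadiiPolynomial
import HarnessLib

/-!
# Strategist sketch s22 — crux `QuantisedSymmetry.PolyhedralDssProfileExists` (X⁻, stmt-NavierStokesRegularity-1404)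

Companion to `Cruxes/PolyhedralDssProfileExists/STRATEGY-CENSUS-s22.md` (second, independent census,
family `-s`). Kernel-checked content, in the census order:

* §1 WEAKER INTERMEDIATE. `negSummit_of_crux`: X⁻ ALONE refutes the Clay statement (the route's
  `closes` with its two proved binders). `sectorFree_of_crux` / `negSummit_of_sectorFree`: deleting every
  group-theoretic clause of X⁻ gives the sector-free statement, which STILL refutes the Clay statement by
  the same sector-agnostic truncation bridge; `blowupProfile_of_crux`: X⁻ dominates route `Blowup`'s crux
  (stmt-0155). So every weakening of X⁻ that still closes this route is itself (C)-bearing, i.e. not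
  "short of the summit"; the sector clauses are load-bearing nowhere on the summit path.
* §2 DECOMPOSITION. The Newton–Kantorovich shell for QUADRATIC systems is a tree theorem
  (`nkShell_quadratic_landed`, `nkShell_newtonLike_landed`); the typed certificate piece
  `CellNKCertificateNaive` (fixed factor `c`, plain invertible linearisation, concrete cell operators
  `heatFlow ∘ zoomDatum` and `oseenDuhamel`) and the split statement `NaiveSplit`. The census explains why
  the naive certificate is refutable (scaling orbit ⇒ NK-uniqueness fails at every nontrivial cell; the
  honest piece is the BORDERED certificate with the factor as an unknown, Reiterer–Trubowitz style) and
  why either certificate, being the only open piece next to a landed shell, dominates the crux.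
* §3 STRENGTHEN. `RotationAbsorbed`: in the polyhedral sector rotated discrete self-similarity is plain
  discrete self-similarity with a power of the factor (statement; group theory of closed subgroups of
  `SO(3)`), so the rotated / rotating-wave strengthenings and weakenings carry nothing.

Nothing here is a registered stub or a route item; no `sorry`.
-/

set_option linter.dupNamespace false

noncomputable section

namespace Summit.NavierStokesRegularity.NavierStokesRegularity.Cruxes.PolyhedralDssProfileExists.StrategistS22

open MeasureTheory Set Function Metric
open Literature.Analysis.FluidPDE
open _root_.Summit.NavierStokesRegularity.NavierStokesRegularity.Theses.QuantisedSymmetry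

/-- `ℝ³`. -/
abbrev E3 := EuclideanSpace ℝ (Fin 3)

/-! ## §1 The crux, and every closing weakening of it, is summit(C)-bearing -/

/-- **X⁻ alone refutes the Clay statement**: the route's deciding theorem `closes` with its two proved
binders (`quantisedSymmetry_polyhedralTruncationBridge_proof`, stmt-11331; `ClayUniqueness_holds`,
stmt-0153). [folklore] -/
theorem negSummit_of_crux (hX : PolyhedralDssProfileExists) : ¬ _root_.NavierStokesRegularity :=
  closes hX
    _root_.Summit.NavierStokesRegularity.NavierStokesRegularity.Theorems.quantisedSymmetry_polyhedralTruncationBridge_proof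
    ClayUniqueness_holds

/-- **X⁻ dominates route `Blowup`'s existence crux** `BlowupTypeIDssProfile` (stmt-0155, the negation of
Tsai's Type-I (rotated) DSS Liouville conjecture) — registered stub `stub_dominatesBlowupProfile`.
[folklore] -/
theorem blowupProfile_of_crux (hX : PolyhedralDssProfileExists) :
    _root_.Summit.NavierStokesRegularity.NavierStokesRegularity.Theses.Blowup.BlowupTypeIDssProfile :=
  _root_.Summit.NavierStokesRegularity.NavierStokesRegularity.Theorems.PolyhedralDssProfileExists.PolyhedralCell.stub_dominatesBlowupProfile
    hX

/-- The SECTOR-FREE weakening of X⁻: the crux with the four group-theoretic clauses (finite `G`,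
`det = 1`, irreducible, `G`-equivariance) deleted — a nontrivial Type-I `λ`-DSS ancient mild solution. -/
def SectorFreeTypeIDssProfileExists : Prop :=
  ∃ c : ℝ, 1 < c ∧ ∃ u : ℝ → E3 → E3,
    IsAncientMildSolution 1 u ∧ (∀ t < 0, AEStronglyMeasurable (u t) volume) ∧
    IsDiscretelySelfSimilar c u ∧ (∃ C₀ : ℝ, HasTypeIDecay C₀ u) ∧ ¬ (∀ t < 0, u t =ᵐ[volume] 0)

/-- X⁻ implies its sector-free weakening (forget the group). [folklore] -/
theorem sectorFree_of_crux (hX : PolyhedralDssProfileExists) : SectorFreeTypeIDssProfileExists := by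
  obtain ⟨G, -, -, -, c, hc, u, hanc, hmeas, hdss, hdec, -, hnt⟩ := hX
  exact ⟨c, hc, u, hanc, hmeas, hdss, hdec, hnt⟩

/-- **The sector-free weakening STILL refutes the Clay statement**, by the same sector-agnostic
truncation bridge (`filamentSkeletonRss_rdssProfileTruncation_proof` at the trivial rotation) and the
proved Clay uniqueness — verbatim the proof of `closes` with the group deleted. So no weakening of X⁻
that keeps this route closable is short of the (negative) summit. [folklore] -/
theorem negSummit_of_sectorFree (h : SectorFreeTypeIDssProfileExists) : ¬ _root_.NavierStokesRegularity := by
  obtain ⟨c, hc, w, hanc, hmeas, hdss, hdec, hnt⟩ := h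
  rintro hA
  obtain ⟨ν, hν, T, hT, u, p, ⟨hcl, hmax⟩, hLH, hdecay⟩ :=
    _root_.Summit.NavierStokesRegularity.NavierStokesRegularity.Theorems.filamentSkeletonRss_rdssProfileTruncation_proof
      ⟨c, LinearIsometryEquiv.refl ℝ E3, w, hc, hanc, hmeas, isRotatedDSS_refl_iff.mpr hdss, hdec, hnt⟩
  have h0 : (0 : ℝ) ∈ Set.Ico 0 T := ⟨le_rfl, hT⟩
  obtain ⟨u', p', hu', hp', hns, hbe⟩ :=
    hA ν hν (u 0) (hcl.contDiff_velocity h0) (hcl.divFree 0 h0) hdecay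
  have heq : ∀ t ∈ Set.Ico 0 T, u' t = u t :=
    ClayUniqueness_holds ν hν (u 0) hdecay u' u p' p T hT hu' hp' hns hbe hcl hLH rfl
  have hcl' : IsClassicalNSSolutionOn (Set.Ici 0) ν 0 u' p' :=
    ⟨hu', hp', fun t ht x => hns.momentum t ht x, fun t ht => hns.divFree t ht⟩
  refine hmax ⟨T + 1, by linarith, u', p', ?_, heq⟩
  exact hcl'.mono (fun t ht => ht.1) (uniqueDiffOn_Ico 0 (T + 1))

/-! ## §2 Decomposition: the NK shell is landed; the certificate is the whole crux -/

/-- **The Newton–Kantorovich shell for quadratic systems is a tree theorem**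
(`Literature.Analysis.Calculus.existsUnique_zero_of_kantorovich_quadratic`, Deuflhard 2011 Thm 2.1 for
`v ↦ g₀ + A v + Q v v`): cited by name, so a split "shell ∧ certificate" has exactly one open piece.
[folklore] -/
alias nkShell_quadratic_landed := _root_.Literature.Analysis.Calculus.existsUnique_zero_of_kantorovich_quadratic

/-- **The radii-polynomial / approximate-inverse form is a tree theorem too**
(`Literature.Analysis.Calculus.existsUnique_zero_of_newtonLike`, Hungria–Lessard–Mireles James 2016
Prop. 1) — the form a computer-assisted certificate would actually feed. [folklore] -/
alias nkShell_newtonLike_landed := _root_.Literature.Analysis.Calculus.existsUnique_zero_of_newtonLike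

/-- The model period (slab) of a `c`-cell. -/
def slab (c : ℝ) : Set ℝ := Set.Icc (-1 : ℝ) (-(c ^ 2)⁻¹)

/-- The datum read off the final slice through the zoom: `a_v(y) = c⁻¹ v(−c⁻², y/c)`, so that the
closing relation `v(−c⁻², x) = c v(−1, c x)` reads `v(−1) = a_v`. -/
def zoomDatum (c : ℝ) (v : ℝ → E3 → E3) : E3 → E3 := fun y => c⁻¹ • v (-(c ^ 2)⁻¹) (c⁻¹ • y)

/-- The LINEAR clauses of a `G`-cell on the slab (jointly continuous, bounded, weakly divergence free,
`G`-equivariant slice by slice) — the closed linear subspace in which Newton's method would run. -/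
def LinearCellClauses (G : Subgroup (E3 ≃ₗᵢ[ℝ] E3)) (c : ℝ) (v : ℝ → E3 → E3) : Prop :=
  ContinuousOn (Function.uncurry v) (slab c ×ˢ Set.univ) ∧
  (∃ M : ℝ, ∀ t ∈ slab c, ∀ x, ‖v t x‖ ≤ M) ∧
  (∀ t ∈ slab c, IsWeaklyDivFree (v t)) ∧
  (∀ g ∈ G, ∀ t ∈ slab c, ∀ x, v t (g x) = g (v t x))

/-- **The NAIVE cell certificate** (fixed factor `c`, plain invertible linearisation). A Banach space
`X` REPRESENTED as fields on the slab (`ι` injective, sup-dominated, values satisfying the linear cell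
clauses) on which the CONCRETE affine part `v ↦ v − heatFlow(a_v)(t+1)` and the CONCRETE bilinear
Oseen–Duhamel form act as bounded operators `A`, `Q`; an approximate cell `x̄`; and the Kantorovich data
of `existsUnique_zero_of_kantorovich_quadratic` at `x̄` (invertible `Φ = A + Q x̄ + Q.flip x̄` with
`‖Φ⁻¹‖ ≤ K`, `‖Q‖ ≤ M`, residual `≤ η`, `h = 4K²Mη < ½`), plus quantitative nontriviality of the datum
beyond the NK radius and `L⁴` data. The representation clauses pin `A`, `Q` to the Navier–Stokes cell
operators, so the certificate cannot be met by a one-dimensional costume. CENSUS VERDICT: refutable as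
typed — zeros of the fixed-`c` cell map come in scaling circles `μ ↦ 𝒮_μ v`, so `Φ` is never invertible
at a nontrivial cell and NK-uniqueness in a ball contradicts the orbit; the honest piece is the BORDERED
certificate (phase condition, `log c` an unknown, time-normalised slab), whose typing needs the strong
time-periodic Leray system in similarity variables (not in the tree). -/
def CellNKCertificateNaive : Prop :=
  ∃ G : Subgroup (E3 ≃ₗᵢ[ℝ] E3), Finite G ∧
    (∀ g ∈ G, LinearMap.det (g.toLinearEquiv : E3 →ₗ[ℝ] E3) = 1) ∧
    (∀ V : Submodule ℝ E3, (∀ g ∈ G, ∀ v ∈ V, g v ∈ V) → V = ⊥ ∨ V = ⊤) ∧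
  ∃ c : ℝ, 1 < c ∧
  ∃ (X : Type) (_ : NormedAddCommGroup X) (_ : NormedSpace ℝ X) (_ : CompleteSpace X)
    (ι : X → (ℝ → E3 → E3)) (A : X →L[ℝ] X) (Q : X →L[ℝ] X →L[ℝ] X) (xbar : X) (Φ : X ≃L[ℝ] X)
    (K M η : ℝ),
    -- (R) representation: `ι` is injective, sup-dominated, cell-valued, and intertwines `A`, `Q`
    --     with the concrete heat/zoom and Oseen–Duhamel operators of the cell problem
    Function.Injective ι ∧
    (∀ x : X, ∀ t ∈ slab c, ∀ y, ‖ι x t y‖ ≤ ‖x‖) ∧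
    (∀ x : X, LinearCellClauses G c (ι x)) ∧
    (∀ x : X, ∀ t ∈ slab c, ∀ y,
      ι (A x) t y = ι x t y - heatFlow (zoomDatum c (ι x)) (t + 1) y) ∧
    (∀ x x' : X, ∀ t ∈ slab c, ∀ y, ι (Q x x') t y = oseenDuhamel 1 (-1) (ι x) (ι x') t y) ∧
    (∀ x : X, MemLp (ι x (-1)) 4 volume) ∧
    -- (NK) the Kantorovich data at `xbar`
    (Φ : X →L[ℝ] X) = A + Q xbar + Q.flip xbar ∧ ‖(Φ.symm : X →L[ℝ] X)‖ ≤ K ∧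
    (∀ u v : X, ‖Q u v‖ ≤ M * ‖u‖ * ‖v‖) ∧ ‖A xbar + Q xbar xbar‖ ≤ η ∧ 0 < K ∧ 0 < M ∧
    2 * (K ^ 2 * (2 * M) * η) < 1 ∧
    -- (N) quantitative nontriviality: the datum of `xbar` exceeds the NK radius somewhere
    (∃ y : E3, (1 - Real.sqrt (1 - 2 * (K ^ 2 * (2 * M) * η))) / (K * (2 * M)) < ‖ι xbar (-1) y‖)

/-- **The naive split, as a statement**: certificate ⇒ crux. Provable from `nkShell_quadratic_landed`,
the representation clauses, the all-pairs Duhamel semigroup identity and `stub_profileOfPolyhedralCell`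
(not done: the certificate piece is refutable as typed and, bordered or not, dominates the crux — see
the census). -/
def NaiveSplit : Prop := CellNKCertificateNaive → PolyhedralDssProfileExists

/-! ## §3 Strengthen: rotation is absorbed in the polyhedral sector -/

/-- **Rotation absorbed (statement).** For a finite irreducible rotation group `G` and a continuous,
slice-wise weakly divergence-free, `G`-equivariant field `u` which is rotated `c`-DSS with rotation `R`
(`c > 1`): either `u ≡ 0` or `u` is plainly `c^m`-DSS for some `m ≥ 1`. (The spatial symmetry group of
`u` is a closed subgroup of `O(3)` containing `G`, normalised by `R`; it is finite — else it contains
`SO(3)` and a continuous solenoidal `SO(3)`-equivariant field vanishes — and the normaliser of a finite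
irreducible rotation group is finite, so `R` has finite order `m`.) Hence RSS / rotating-wave ansätze
are unavailable in the sector and the rotated conjunct of stmt-0155 is vacuous there. [folklore] -/
def RotationAbsorbed : Prop :=
  ∀ G : Subgroup (E3 ≃ₗᵢ[ℝ] E3), Finite G →
    (∀ g ∈ G, LinearMap.det (g.toLinearEquiv : E3 →ₗ[ℝ] E3) = 1) →
    (∀ V : Submodule ℝ E3, (∀ g ∈ G, ∀ v ∈ V, g v ∈ V) → V = ⊥ ∨ V = ⊤) →
    ∀ (c : ℝ) (R : E3 ≃ₗᵢ[ℝ] E3) (u : ℝ → E3 → E3), 1 < c → IsRotatedDSS c R u →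
      (∀ t, Continuous (u t)) → (∀ t, IsWeaklyDivFree (u t)) →
      (∀ g ∈ G, ∀ t x, u t (g x) = g (u t x)) →
      (∀ t x, u t x = 0) ∨ ∃ m : ℕ, 0 < m ∧ IsDiscretelySelfSimilar (c ^ m) u

end Summit.NavierStokesRegularity.NavierStokesRegularity.Cruxes.PolyhedralDssProfileExists.StrategistS22
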